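import Mathlib
import Summits.Ventures.PercRepro2.KPrimeReduction
import Summits.Ventures.PercRepro2.KPrimeSure
import Summits.Ventures.PercRepro2.KPrimeEdgeSteps
import Summits.Ventures.PercRepro2.KPrimePendantLemmas

/-!
# The mark `b` pendant at the root `a₁`: an EQUALITY instance of `(K′)`
(blind cell PercRepro2, mine-c g37; `conjectures/MINE-C.md` §45.9, §46.3)

Let the mark `b` be a LEAF whose only edge is `e₁ = {b, a₁}` (weight `q = p e₁`, any value in
`[0, 1]`).  Then `{a₁ ↔ b}` is exactly the event `{e₁ open}` (`connEvent_eq_openEdge_of_leaf`),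
every event among the other vertices is flip-invariant at `e₁`, and so every `X`-mass of the
cleared `(K′)`-form is `q` times its base mass (`prob_inter_openEdge_of_flipInvAt`):
`P(U∩X∩Ω) = q·P(U∩Ω)`, `P(X∩N) = q·P(N)`, `P(U∩Y∩X∩Ω) = q·P(U∩Y∩Ω)`, `P((0,1)ᵉ) = q·P((0,1))`.
The cleared form `(A·D₀ − N₀·H)·YS + Sm·((O1e·D₀ − N₀·O1) − (C·D₀ − N₀·D))` then vanishes
identically (`kprimeForm_eq_zero_of_pendant_b`), for EVERY weight vector on the other edges:
the b-pendant-at-`a₁` instances form an equality locus of `(K′)` (`kprimeHolds_of_pendant_b`),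
the locus around which every known pocket of the damped step `(STEP-v)₁` sits
(`MINE-C.md` §45.9) and at which `(K′)` linearises as `(1 − q)·β·[form(b := z′) + q·Glue]`
(`MINE-C.md` §46.3).
-/

namespace Summit.Ventures.PercRepro2

namespace KPrime

variable {V : Type*} {E : Type*} [Fintype E] [DecidableEq E] [Fintype V] [DecidableEq V]
  {R : Type*} [Field R] [LinearOrder R] [IsStrictOrderedRing R]

section PendantB

variable {ends : E → Sym2 V} {a₁ a₂ b v y : V} {p : E → R} {e₁ : E}

omit [Fintype E] [DecidableEq E] [Fintype V] [DecidableEq V] [Field R] [LinearOrder R]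
  [IsStrictOrderedRing R] in
/-- For a leaf `b` with the single edge `e₁ = {b, a₁}`, the connection `a₁ ↔ b` is exactly
`e₁` open. -/
lemma connEvent_eq_openEdge_of_leaf (hleaf : ∀ f, b ∈ ends f → f = e₁)
    (hends : ends e₁ = s(b, a₁)) (hb : b ≠ a₁) :
    connEvent ends a₁ b = openEdge e₁ := by
  ext ω
  simp only [mem_connEvent, mem_openEdge]
  constructor
  · intro h
    by_contra hne
    have hfalse : ω e₁ = false := by simpa using hne
    exact hb (conn_eq_of_isolated hleaf hfalse (conn_symm h)).symm
  · intro h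
    exact conn_symm (conn_of_openAdj ⟨e₁, h, hends⟩)

omit [Fintype E] [DecidableEq E] [Fintype V] [DecidableEq V] [Field R] [LinearOrder R]
  [IsStrictOrderedRing R] in
/-- For a leaf `b` with the single edge `e₁`, any connection `x ↔ b` with `x ≠ b` forces `e₁`
open. -/
lemma connEvent_subset_openEdge_of_leaf (hleaf : ∀ f, b ∈ ends f → f = e₁) {x : V}
    (hx : x ≠ b) : connEvent ends x b ⊆ openEdge e₁ := by
  intro ω h
  rw [mem_connEvent] at h
  rw [mem_openEdge]
  by_contra hne
  have hfalse : ω e₁ = false := by simpa using hne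
  exact hx (conn_eq_of_isolated hleaf hfalse (conn_symm h))

omit [Fintype V] [DecidableEq V] [IsStrictOrderedRing R] in
/-- **The pendant-mass identity**: for an event `A` flip-invariant at the leaf edge `e₁`,
`P(A ∩ {e₁ open}) = p e₁ · P(A)` (for every value of `p e₁`, including `1`). -/
lemma prob_inter_openEdge_of_flipInvAt {A : Set (Config E)} (hA : FlipInvAt p e₁ A) :
    prob p (A ∩ openEdge e₁) = p e₁ * prob p A := by
  by_cases he : p e₁ = 1
  · have hp1 : Function.update p e₁ 1 = p := by
      rw [← he]
      exact Function.update_eq_self e₁ p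
    calc prob p (A ∩ openEdge e₁)
        = prob (Function.update p e₁ 1) (A ∩ openEdge e₁) := by rw [hp1]
      _ = prob (Function.update p e₁ 1) A := prob_update_one_inter_openEdge _ _ _
      _ = p e₁ * prob p A := by rw [hp1, he, one_mul]
  · rw [prob_eq_pin p (A ∩ openEdge e₁) e₁, prob_update_one_inter_openEdge,
      prob_update_zero_inter_openEdge, mul_zero, add_zero, prob_eq_pin p A e₁,
      prob_update_one_eq_update_zero_of_flipInvAt he hA]
    ring

omit [Fintype V] [DecidableEq V] [IsStrictOrderedRing R] in
/-- The `X`-version of a flip-invariant event, written as `A ∩ connEvent a₁ b`, has mass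
`p e₁ · P(A)` when `b` is a leaf at `a₁`. -/
lemma prob_inter_connEvent_of_leaf (hleaf : ∀ f, b ∈ ends f → f = e₁)
    (hends : ends e₁ = s(b, a₁)) (hb : b ≠ a₁) {A : Set (Config E)} (hA : FlipInvAt p e₁ A) :
    prob p (A ∩ connEvent ends a₁ b) = p e₁ * prob p A := by
  rw [connEvent_eq_openEdge_of_leaf hleaf hends hb]
  exact prob_inter_openEdge_of_flipInvAt hA

omit [Fintype E] [Fintype V] [DecidableEq V] [IsStrictOrderedRing R] in
/-- Flip invariance of the world `Ω = {a₁ ↮ a₂}` at a leaf edge of `b` (`b ≠ a₁, a₂`). -/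
lemma flipInvAt_Ω (hleaf : ∀ f, b ∈ ends f → f = e₁) (hends : ends e₁ = s(b, a₁))
    (hb₁ : a₁ ≠ b) (hb₂ : a₂ ≠ b) : FlipInvAt p e₁ (Ω ends a₁ a₂) :=
  flipInvAt_avoidAll hleaf hends hb₁ (by simpa using hb₂)

omit [Fintype E] [Fintype V] [IsStrictOrderedRing R] in
/-- Flip invariance of `S = {a₂ ↮ {a₁, v}}` at a leaf edge of `b`. -/
lemma flipInvAt_S (hleaf : ∀ f, b ∈ ends f → f = e₁) (hends : ends e₁ = s(b, a₁))
    (hb₁ : a₁ ≠ b) (hb₂ : a₂ ≠ b) (hbv : v ≠ b) : FlipInvAt p e₁ (S ends a₁ a₂ v) := by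
  refine flipInvAt_avoidAll hleaf hends hb₂ ?_
  intro x hx
  simp only [Finset.mem_insert, Finset.mem_singleton] at hx
  rcases hx with rfl | rfl
  · exact hb₁
  · exact hbv

omit [Fintype E] [Fintype V] [IsStrictOrderedRing R] in
/-- Flip invariance of `N = {a₁ ↮ {a₂, v}}` at a leaf edge of `b`. -/
lemma flipInvAt_N (hleaf : ∀ f, b ∈ ends f → f = e₁) (hends : ends e₁ = s(b, a₁))
    (hb₁ : a₁ ≠ b) (hb₂ : a₂ ≠ b) (hbv : v ≠ b) : FlipInvAt p e₁ (N ends a₁ a₂ v) := by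
  refine flipInvAt_avoidAll hleaf hends hb₁ ?_
  intro x hx
  simp only [Finset.mem_insert, Finset.mem_singleton] at hx
  rcases hx with rfl | rfl
  · exact hb₂
  · exact hbv

omit [Fintype E] [Fintype V] [IsStrictOrderedRing R] in
/-- Flip invariance of the class `(0,1) = {v ∉ C₁, y ∈ C₁} ∩ S` at a leaf edge of `b`. -/
lemma flipInvAt_cls01 (hleaf : ∀ f, b ∈ ends f → f = e₁) (hends : ends e₁ = s(b, a₁))
    (hb₁ : a₁ ≠ b) (hb₂ : a₂ ≠ b) (hbv : v ≠ b) (hby : y ≠ b) :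
    FlipInvAt p e₁ (cls01 ends a₁ a₂ v y) :=
  ((flipInvAt_connEvent hleaf hends hb₁ hbv).compl.inter
    (flipInvAt_connEvent hleaf hends hb₁ hby)).inter (flipInvAt_S hleaf hends hb₁ hb₂ hbv)

omit [Fintype E] [DecidableEq E] [Fintype V] [IsStrictOrderedRing R] in
/-- The glued class `(0,1)ᵉ` of a leaf `b` at `a₁` is `(0,1) ∩ {e₁ open}`: `b ∈ C₁ ∪ C(v)`
forces the leaf edge open, and with it open `b ∈ C₁`. -/
lemma cls01e_eq_of_leaf (hleaf : ∀ f, b ∈ ends f → f = e₁) (hends : ends e₁ = s(b, a₁))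
    (hb₁ : a₁ ≠ b) (hbv : v ≠ b) :
    cls01e ends a₁ a₂ b v y = cls01 ends a₁ a₂ v y ∩ openEdge e₁ := by
  have hX : connEvent ends a₁ b = openEdge e₁ :=
    connEvent_eq_openEdge_of_leaf hleaf hends (Ne.symm hb₁)
  have hU : connEvent ends a₁ b ∪ connEvent ends v b = openEdge e₁ := by
    apply Set.Subset.antisymm
    · exact Set.union_subset hX.le (connEvent_subset_openEdge_of_leaf hleaf hbv)
    · exact hX.ge.trans Set.subset_union_left
  show cls01 ends a₁ a₂ v y ∩ (connEvent ends a₁ b ∪ connEvent ends v b) =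
    cls01 ends a₁ a₂ v y ∩ openEdge e₁
  rw [hU]

omit [Fintype V] [IsStrictOrderedRing R] in
/-- **THEOREM (the b-pendant-at-`a₁` equality locus)**: if the mark `b` is a leaf whose only
edge is `e₁ = {b, a₁}`, the cleared `(K′)`-form at the lean `(P(X∩N), P(N))` vanishes
identically — for every weight of `e₁` and every weight vector on the other edges. -/
theorem kprimeForm_eq_zero_of_pendant_b (hleaf : ∀ f, b ∈ ends f → f = e₁)
    (hends : ends e₁ = s(b, a₁)) (hb₁ : a₁ ≠ b) (hb₂ : a₂ ≠ b) (hbv : v ≠ b) (hby : y ≠ b) :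
    kprimeForm ends a₁ a₂ b v y p (prob p (connEvent ends a₁ b ∩ N ends a₁ a₂ v))
      (prob p (N ends a₁ a₂ v)) = 0 := by
  -- the four X-masses as `q` times their base masses
  have hA : prob p (connEvent ends a₁ v ∩ connEvent ends a₁ b ∩ Ω ends a₁ a₂) =
      p e₁ * prob p (connEvent ends a₁ v ∩ Ω ends a₁ a₂) := by
    rw [Set.inter_right_comm]
    exact prob_inter_connEvent_of_leaf hleaf hends (Ne.symm hb₁)
      ((flipInvAt_connEvent hleaf hends hb₁ hbv).inter (flipInvAt_Ω hleaf hends hb₁ hb₂))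
  have hN₀ : prob p (connEvent ends a₁ b ∩ N ends a₁ a₂ v) =
      p e₁ * prob p (N ends a₁ a₂ v) := by
    rw [Set.inter_comm]
    exact prob_inter_connEvent_of_leaf hleaf hends (Ne.symm hb₁)
      (flipInvAt_N hleaf hends hb₁ hb₂ hbv)
  have hC : prob p (connEvent ends a₁ v ∩ connEvent ends a₂ y ∩ connEvent ends a₁ b ∩
      Ω ends a₁ a₂) = p e₁ * prob p (connEvent ends a₁ v ∩ connEvent ends a₂ y ∩ Ω ends a₁ a₂) := by
    rw [Set.inter_right_comm]
    exact prob_inter_connEvent_of_leaf hleaf hends (Ne.symm hb₁)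
      (((flipInvAt_connEvent hleaf hends hb₁ hbv).inter
        (flipInvAt_connEvent hleaf hends hb₂ hby)).inter (flipInvAt_Ω hleaf hends hb₁ hb₂))
  have hO1e : prob p (cls01e ends a₁ a₂ b v y) = p e₁ * prob p (cls01 ends a₁ a₂ v y) := by
    rw [cls01e_eq_of_leaf hleaf hends hb₁ hbv]
    exact prob_inter_openEdge_of_flipInvAt (flipInvAt_cls01 hleaf hends hb₁ hb₂ hbv hby)
  unfold kprimeForm
  rw [hA, hN₀, hC, hO1e]
  ring

omit [Fintype V] [IsStrictOrderedRing R] in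
/-- **COROLLARY**: `(K′)` holds (with equality) at every instance whose mark `b` is a leaf at
`a₁` — the equality locus of `MINE-C.md` §45.9 / §46.3. -/
theorem kprimeHolds_of_pendant_b (hleaf : ∀ f, b ∈ ends f → f = e₁)
    (hends : ends e₁ = s(b, a₁)) (hb₁ : a₁ ≠ b) (hb₂ : a₂ ≠ b) (hbv : v ≠ b) (hby : y ≠ b) :
    KPrimeHolds ends a₁ a₂ b v y p := by
  unfold KPrimeHolds
  rw [kprimeForm_eq_zero_of_pendant_b hleaf hends hb₁ hb₂ hbv hby]

end PendantB

end KPrime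

end Summit.Ventures.PercRepro2
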